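import Literature.Computability.QuantumAlgorithms.CliffordTwistedConvolution
import Mathlib.LinearAlgebra.Matrix.ToLin
import Mathlib.LinearAlgebra.Matrix.Trace
import Mathlib.LinearAlgebra.Matrix.ConjTranspose
import Mathlib.Algebra.Star.Unitary
import Mathlib.LinearAlgebra.UnitaryGroup
import Mathlib.Algebra.Star.BigOperators
import Mathlib.Algebra.CharP.Invertible
import Mathlib.Analysis.Complex.Basic
import Mathlib.Algebra.Order.BigOperators.Ring.Finset

/-!
# The doubled Clifford module: `2k` anticommuting signed-permutation unitaries on `ℂ_F[(ℤ/2)ᵏ]` (DEQ-A118 support, part 2/3)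

HONEST FRAMING: instance-level adjudication of specific advantage claims; no claim about
BQP vs BPP or the summit.

Context as in `CliffordFamilyRep` (part 1).  On the twisted group algebra `ℂ_F[(ℤ/2)ᵏ]` with unit
weights (`ones k`, i.e. `Cℓ_{k,0}(ℂ)` in the vocabulary of
`Literature.Computability.QuantumAlgorithms.CliffordTwistedConvolution`) the `2k` operators
`L_{e_j}` (left multiplication by a generator) and `R_{e_j} ∘ α` (right multiplication followed by
the grade involution `α : e_t ↦ (−1)^{|t|}e_t`) pairwise ANTICOMMUTE and square to `+1` resp. `−1`
(`modelMat_anticomm`, `modelMat_mul_self` — from `gp_assoc` and the generator relations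
`gp_gen_gen_add_gp_gen_gen`, `gp_gen_gen_self` of the Literature file); as `2ᵏ × 2ᵏ` matrices
(`modelMat`, via `LinearMap.toMatrixAlgEquiv'`) they are signed permutation matrices
(`modelMat_inl_apply`, `modelMat_inr_apply`), hence unitary (`modelMat_mem_unitaryGroup`).
This is the standard realisation of `Cℓ_{2k}` on `Cℓ_k` by left and twisted right multiplications;
part 3 (`CliffordNormCeiling`) restricts it to `n ≤ 2k` generators.  No `sorry`, no named fact; the
definitions (`psgn`, `gradeInv`, `leftGen`, `rightGen`, `Lm`, `Rm`, `Am`, `modelMat`, `modelSq`) are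
proof scaffolding with bodies.
-/

noncomputable section

open Finset
open Literature.Computability.QuantumAlgorithms.CliffordTwistedConvolution

namespace Summit.QuantumAdvantage.Dequantization.CliffordDoubleModel

variable {k : ℕ}

/-- Unit weights: the model algebra is `ℂ_F[(ℤ/2)ᵏ]` with `eⱼ² = 1` for all `j`. -/
abbrev ones (k : ℕ) : Fin k → ℂ := fun _ => 1

/-- Every blade index is an involution: `x ⊕ x = 0`. -/
theorem blade_add_self (x : Blade k) : x + x = 0 := by
  funext i; exact BooleanRing.add_self (x i)

/-- `x ⊕ (x ⊕ z) = z`. -/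
theorem blade_add_add_cancel (x z : Blade k) : x + (x + z) = z := by
  rw [← add_assoc, blade_add_self, zero_add]

/-- The parity sign `(−1)^{|t|}` of a blade. -/
def psgn (t : Blade k) : ℂ := ∏ i, if t i = true then (-1 : ℂ) else 1

/-- The parity sign is a character: `(−1)^{|s ⊕ t|} = (−1)^{|s|} (−1)^{|t|}`. -/
theorem psgn_add (s t : Blade k) : psgn (s + t) = psgn s * psgn t := by
  unfold psgn
  rw [← Finset.prod_mul_distrib]
  refine Finset.prod_congr rfl fun i _ => ?_
  rw [add_apply_eq_xor]
  cases s i <;> cases t i <;> simp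

/-- A generator is odd: `(−1)^{|δⱼ|} = −1`. -/
theorem psgn_gen (j : Fin k) : psgn (gen j) = -1 := by
  unfold psgn
  rw [Finset.prod_eq_single j]
  · simp [gen]
  · intro i _ hij
    simp [gen, hij]
  · simp

/-- `((−1)^{|t|})² = 1`. -/
theorem psgn_mul_self (t : Blade k) : psgn t * psgn t = 1 := by
  unfold psgn
  rw [← Finset.prod_mul_distrib]
  exact Finset.prod_eq_one fun i _ => by split_ifs <;> norm_num

/-- The parity sign is real. -/
theorem star_psgn (t : Blade k) : star (psgn t) = psgn t := by
  unfold psgn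
  rw [star_prod]
  exact Finset.prod_congr rfl fun i _ => by split_ifs <;> simp

/-- For unit weights the cocycle is the exchange sign. -/
theorem twist_ones (x y : Blade k) : twist (ones k) x y = exchSign ℂ x y := by
  unfold twist metricFactor
  simp

/-- The exchange sign is real. -/
theorem star_exchSign (x y : Blade k) : star (exchSign ℂ x y) = exchSign ℂ x y := by
  rw [exchSign_eq_neg_one_pow, star_pow, star_neg, star_one]

/-- The exchange sign is unimodular. -/
theorem star_exchSign_mul_self (x y : Blade k) : star (exchSign ℂ x y) * exchSign ℂ x y = 1 := by
  rw [star_exchSign, exchSign_mul_self]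

/-- The grade involution `α : e_t ↦ (−1)^{|t|} e_t`. -/
def gradeInv : MV k ℂ →ₗ[ℂ] MV k ℂ where
  toFun a := fun t => psgn t * a t
  map_add' a b := by funext t; simp only [Pi.add_apply]; ring
  map_smul' c a := by funext t; simp only [Pi.smul_apply, smul_eq_mul, RingHom.id_apply]; ring

/-- `(α a)_t = (−1)^{|t|} a_t`. -/
theorem gradeInv_apply (a : MV k ℂ) (t : Blade k) : gradeInv a t = psgn t * a t := rfl

/-- Right multiplication by the generator `eⱼ` (unit weights). -/
def rightGen (j : Fin k) : MV k ℂ →ₗ[ℂ] MV k ℂ where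
  toFun a := gp (ones k) a (bladeVec ℂ (gen j))
  map_add' a b := by simp only [gp_eq_twConv, twConv_add_left]
  map_smul' c a := by simp only [gp_smul_left, RingHom.id_apply]

/-- `R_{e_j} a = a · e_j`. -/
theorem rightGen_apply (j : Fin k) (a : MV k ℂ) : rightGen j a = gp (ones k) a (bladeVec ℂ (gen j)) := rfl

/-- Left multiplication by the generator `eⱼ` (unit weights). -/
def leftGen (j : Fin k) : MV k ℂ →ₗ[ℂ] MV k ℂ := leftMul (ones k) (bladeVec ℂ (gen j))

/-- `L_{e_j} a = e_j · a`. -/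
theorem leftGen_apply (j : Fin k) (a : MV k ℂ) : leftGen j a = gp (ones k) (bladeVec ℂ (gen j)) a := rfl

/-- Left distributivity of the twisted product. -/
theorem gp_add_left' (w : Fin k → ℂ) (a a' b : MV k ℂ) : gp w (a + a') b = gp w a b + gp w a' b := by
  simp only [gp_eq_twConv, twConv_add_left]

/-- Right distributivity of the twisted product. -/
theorem gp_add_right' (w : Fin k → ℂ) (a b b' : MV k ℂ) : gp w a (b + b') = gp w a b + gp w a b' := by
  simp only [gp_eq_twConv, twConv_add_right]

/-- Coefficients of a left product by a blade: `(e_x · b)_t = F(x, x⊕t) b_{x⊕t}`. -/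
theorem gp_bladeVec_left_apply (w : Fin k → ℂ) (x : Blade k) (b : MV k ℂ) (t : Blade k) :
    gp w (bladeVec ℂ x) b t = twist w x (x + t) * b (x + t) := by
  rw [gp_eq_twConv]
  simp only [twConv]
  rw [Finset.sum_eq_single x]
  · simp [bladeVec]; ring
  · intro y _ hy
    simp [bladeVec, hy]
  · simp

/-- Coefficients of a right product by a blade: `(a · e_y)_t = a_{y⊕t} F(y⊕t, y)`. -/
theorem gp_bladeVec_right_apply (w : Fin k → ℂ) (a : MV k ℂ) (y t : Blade k) :
    gp w a (bladeVec ℂ y) t = a (y + t) * twist w (y + t) y := by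
  rw [gp_eq_twConv]
  simp only [twConv]
  rw [Finset.sum_eq_single (y + t)]
  · have h : y + t + t = y := by rw [add_assoc, blade_add_self, add_zero]
    simp [bladeVec, h]
  · intro x _ hx
    have h : x + t ≠ y := fun h' => hx (by rw [← h', add_assoc, blade_add_self, add_zero])
    simp [bladeVec, h]
  · simp

/-- `L_{e_i} L_{e_j} + L_{e_j} L_{e_i} = 0` for `i ≠ j`. -/
theorem leftGen_anticomm {i j : Fin k} (h : i ≠ j) : leftGen i * leftGen j + leftGen j * leftGen i = 0 := by
  apply LinearMap.ext; intro b
  simp only [LinearMap.add_apply, Module.End.mul_apply, leftGen_apply, LinearMap.zero_apply]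
  rw [← gp_assoc, ← gp_assoc, ← gp_add_left', gp_gen_gen_add_gp_gen_gen _ h, gp_eq_twConv,
    twConv_zero_left]

/-- `L_{e_j}² = 1` (unit weights). -/
theorem leftGen_mul_self (j : Fin k) : leftGen j * leftGen j = 1 := by
  apply LinearMap.ext; intro b
  simp only [Module.End.mul_apply, leftGen_apply, Module.End.one_apply]
  rw [← gp_assoc, gp_gen_gen_self, one_smul, gp_one_left]

/-- `R_{e_i} R_{e_j} + R_{e_j} R_{e_i} = 0` for `i ≠ j`. -/
theorem rightGen_anticomm {i j : Fin k} (h : i ≠ j) : rightGen i * rightGen j + rightGen j * rightGen i = 0 := by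
  apply LinearMap.ext; intro b
  simp only [LinearMap.add_apply, Module.End.mul_apply, rightGen_apply, LinearMap.zero_apply]
  rw [gp_assoc, gp_assoc, ← gp_add_right', gp_gen_gen_add_gp_gen_gen _ h.symm, gp_eq_twConv,
    twConv_zero_right]

/-- `R_{e_j}² = 1` (unit weights). -/
theorem rightGen_mul_self (j : Fin k) : rightGen j * rightGen j = 1 := by
  apply LinearMap.ext; intro b
  simp only [Module.End.mul_apply, rightGen_apply, Module.End.one_apply]
  rw [gp_assoc, gp_gen_gen_self, one_smul, gp_one_right]

/-- Left and right multiplications commute (associativity). -/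
theorem leftGen_comm_rightGen (i j : Fin k) : leftGen i * rightGen j = rightGen j * leftGen i := by
  apply LinearMap.ext; intro b
  simp only [Module.End.mul_apply, rightGen_apply, leftGen_apply]
  rw [gp_assoc]

/-- `α² = 1`. -/
theorem gradeInv_mul_self : (gradeInv : MV k ℂ →ₗ[ℂ] MV k ℂ) * gradeInv = 1 := by
  apply LinearMap.ext; intro b; funext t
  simp only [Module.End.mul_apply, gradeInv_apply, Module.End.one_apply]
  rw [← mul_assoc, psgn_mul_self, one_mul]

/-- `α` anticommutes with `L_{e_j}` (a generator flips the parity). -/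
theorem gradeInv_leftGen (j : Fin k) : gradeInv * leftGen j + leftGen j * gradeInv = 0 := by
  apply LinearMap.ext; intro b; funext t
  simp only [LinearMap.add_apply, Pi.add_apply, Module.End.mul_apply, gradeInv_apply, leftGen_apply,
    LinearMap.zero_apply, Pi.zero_apply, gp_bladeVec_left_apply]
  rw [psgn_add, psgn_gen]
  ring

/-- `α` anticommutes with `R_{e_j}`. -/
theorem gradeInv_rightGen (j : Fin k) : gradeInv * rightGen j + rightGen j * gradeInv = 0 := by
  apply LinearMap.ext; intro b; funext t
  simp only [LinearMap.add_apply, Pi.add_apply, Module.End.mul_apply, gradeInv_apply, rightGen_apply,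
    LinearMap.zero_apply, Pi.zero_apply, gp_bladeVec_right_apply]
  rw [psgn_add, psgn_gen]
  ring

/-! #### The same operators as matrices (all further algebra is done in `M_{2ᵏ}(ℂ)`) -/

/-- `L_{e_j}` as a matrix. -/
def Lm (j : Fin k) : Matrix (Blade k) (Blade k) ℂ := LinearMap.toMatrixAlgEquiv' (leftGen j)
/-- `R_{e_j}` as a matrix. -/
def Rm (j : Fin k) : Matrix (Blade k) (Blade k) ℂ := LinearMap.toMatrixAlgEquiv' (rightGen j)
/-- The grade involution as a matrix. -/
def Am : Matrix (Blade k) (Blade k) ℂ := LinearMap.toMatrixAlgEquiv' (gradeInv (k := k))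

/-- Matrix form of `leftGen_anticomm`. -/
theorem Lm_anticomm {i j : Fin k} (h : i ≠ j) : Lm i * Lm j + Lm j * Lm i = 0 := by
  rw [Lm, Lm, ← map_mul, ← map_mul, ← map_add, leftGen_anticomm h, map_zero]
/-- Matrix form of `leftGen_mul_self`. -/
theorem Lm_mul_self (j : Fin k) : Lm j * Lm j = 1 := by
  rw [Lm, ← map_mul, leftGen_mul_self, map_one]
/-- Matrix form of `rightGen_anticomm`. -/
theorem Rm_anticomm {i j : Fin k} (h : i ≠ j) : Rm i * Rm j + Rm j * Rm i = 0 := by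
  rw [Rm, Rm, ← map_mul, ← map_mul, ← map_add, rightGen_anticomm h, map_zero]
/-- Matrix form of `rightGen_mul_self`. -/
theorem Rm_mul_self (j : Fin k) : Rm j * Rm j = 1 := by
  rw [Rm, ← map_mul, rightGen_mul_self, map_one]
/-- Matrix form of `leftGen_comm_rightGen`. -/
theorem Lm_comm_Rm (i j : Fin k) : Lm i * Rm j = Rm j * Lm i := by
  rw [Lm, Rm, ← map_mul, ← map_mul, leftGen_comm_rightGen]
/-- Matrix form of `gradeInv_mul_self`. -/
theorem Am_mul_self : (Am : Matrix (Blade k) (Blade k) ℂ) * Am = 1 := by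
  rw [Am, ← map_mul, gradeInv_mul_self, map_one]
/-- Matrix form of `gradeInv_leftGen`. -/
theorem Am_Lm (j : Fin k) : Am * Lm j = -(Lm j * Am) := by
  apply eq_neg_of_add_eq_zero_left
  rw [Am, Lm, ← map_mul, ← map_mul, ← map_add, gradeInv_leftGen, map_zero]
/-- Matrix form of `gradeInv_rightGen`. -/
theorem Am_Rm (j : Fin k) : Am * Rm j = -(Rm j * Am) := by
  apply eq_neg_of_add_eq_zero_left
  rw [Am, Rm, ← map_mul, ← map_mul, ← map_add, gradeInv_rightGen, map_zero]

/-- The `2k` model matrices: `L_{e_j}` and `R_{e_j} α`. -/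
def modelMat : Fin k ⊕ Fin k → Matrix (Blade k) (Blade k) ℂ
  | Sum.inl j => Lm j
  | Sum.inr j => Rm j * Am

/-- Their squares: `L_{e_j}² = 1`, `(R_{e_j} α)² = −1`. -/
def modelSq : Fin k ⊕ Fin k → ℂ
  | Sum.inl _ => 1
  | Sum.inr _ => -1

/-- The model squares are `±1`. -/
theorem modelSq_cases (ι : Fin k ⊕ Fin k) : modelSq ι = 1 ∨ modelSq ι = -1 := by
  cases ι <;> simp [modelSq]

/-- The model squares are non-zero. -/
theorem modelSq_ne_zero (ι : Fin k ⊕ Fin k) : modelSq ι ≠ 0 := by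
  rcases modelSq_cases ι with h | h <;> rw [h] <;> norm_num

/-- Each model matrix squares to `±1`: `L_{e_j}² = 1`, `(R_{e_j}α)² = −R_{e_j}²α² = −1`. -/
theorem modelMat_mul_self (ι : Fin k ⊕ Fin k) :
    modelMat ι * modelMat ι = modelSq ι • (1 : Matrix (Blade k) (Blade k) ℂ) := by
  cases ι with
  | inl j => simp only [modelMat, modelSq, Lm_mul_self, one_smul]
  | inr j =>
      simp only [modelMat, modelSq]
      rw [mul_assoc, ← mul_assoc Am, Am_Rm, neg_mul, mul_neg, mul_assoc, Am_mul_self, mul_one,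
        Rm_mul_self, neg_one_smul]

/-- **The `2k` model matrices pairwise anticommute** (`L`'s among themselves, `Rα`'s among themselves, and `L_{e_i}` with `R_{e_j}α` because `L` and `R` commute while `α` anticommutes with both). -/
theorem modelMat_anticomm {ι κ : Fin k ⊕ Fin k} (h : ι ≠ κ) :
    modelMat ι * modelMat κ + modelMat κ * modelMat ι = 0 := by
  cases ι with
  | inl i =>
      cases κ with
      | inl j =>
          simp only [modelMat]
          exact Lm_anticomm fun hij => h (by rw [hij])
      | inr j =>
          simp only [modelMat]
          rw [← mul_assoc, Lm_comm_Rm, mul_assoc, mul_assoc, Am_Lm, mul_neg, add_neg_cancel]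
  | inr i =>
      cases κ with
      | inl j =>
          simp only [modelMat]
          rw [← mul_assoc (Lm j), Lm_comm_Rm, mul_assoc, mul_assoc, Am_Lm, mul_neg, neg_add_cancel]
      | inr j =>
          simp only [modelMat]
          have hij : i ≠ j := fun hij => h (by rw [hij])
          calc Rm i * Am * (Rm j * Am) + Rm j * Am * (Rm i * Am)
              = Rm i * (Am * Rm j) * Am + Rm j * (Am * Rm i) * Am := by
                simp only [mul_assoc]
            _ = -((Rm i * Rm j + Rm j * Rm i) * (Am * Am)) := by
                rw [Am_Rm, Am_Rm]; simp only [mul_neg, neg_mul, mul_assoc, add_mul, neg_add]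
            _ = 0 := by rw [Rm_anticomm hij, zero_mul, neg_zero]

/-- Mathlib's `Pi.single t 1` is the blade `e_t`. -/
theorem single_eq_bladeVec (t : Blade k) : (Pi.single t (1 : ℂ) : MV k ℂ) = bladeVec ℂ t := by
  funext s; simp [bladeVec, Pi.single_apply]

/-- A monomial matrix `P s t = [s = g ⊕ t] φ(t)` with unimodular `φ` is unitary. -/
theorem monomial_mem_unitaryGroup (P : Matrix (Blade k) (Blade k) ℂ) (g : Blade k) (φ : Blade k → ℂ)
    (hP : ∀ s t, P s t = if s = g + t then φ t else 0) (hφ : ∀ t, star (φ t) * φ t = 1) :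
    P ∈ Matrix.unitaryGroup (Blade k) ℂ := by
  rw [Matrix.mem_unitaryGroup_iff']
  ext s t
  rw [Matrix.mul_apply, Matrix.one_apply, Finset.sum_eq_single (g + s)]
  · rw [Matrix.star_apply, hP, hP, if_pos rfl]
    by_cases hst : s = t
    · subst hst; rw [if_pos rfl, if_pos rfl, hφ]
    · have hne : g + s ≠ g + t := fun h' => hst (add_left_cancel h')
      rw [if_neg hne, if_neg hst, mul_zero]
  · intro u _ hu
    rw [Matrix.star_apply, hP u s, if_neg hu, star_zero, zero_mul]
  · intro h; exact absurd (Finset.mem_univ _) h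

/-- Entries of `L_{e_j}`: a signed permutation matrix, `(L_{e_j})_{s,t} = [s = δⱼ ⊕ t] F(δⱼ, t)`. -/
theorem modelMat_inl_apply (j : Fin k) (s t : Blade k) :
    modelMat (Sum.inl j) s t = if s = gen j + t then twist (ones k) (gen j) t else 0 := by
  rw [modelMat, Lm, LinearMap.toMatrixAlgEquiv'_apply, single_eq_bladeVec]
  simp only [leftGen_apply, gp_bladeVec_bladeVec, Pi.smul_apply, bladeVec, smul_eq_mul,
    mul_ite, mul_one, mul_zero]

/-- Entries of `R_{e_j} α`: `(R_{e_j}α)_{s,t} = [s = δⱼ ⊕ t] (−1)^{|t|} F(t, δⱼ)`. -/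
theorem modelMat_inr_apply (j : Fin k) (s t : Blade k) :
    modelMat (Sum.inr j) s t = if s = gen j + t then psgn t * twist (ones k) t (gen j) else 0 := by
  rw [modelMat, Rm, Am, ← map_mul, LinearMap.toMatrixAlgEquiv'_apply, single_eq_bladeVec]
  have hα : gradeInv (bladeVec ℂ t) = psgn t • bladeVec ℂ t := by
    funext s
    simp only [gradeInv_apply, Pi.smul_apply, bladeVec, smul_eq_mul]
    split_ifs with h
    · rw [h]
    · rw [mul_zero, mul_zero]
  simp only [Module.End.mul_apply, hα, map_smul, rightGen_apply, gp_bladeVec_bladeVec,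
    Pi.smul_apply, bladeVec, smul_eq_mul, mul_ite, mul_one, mul_zero, add_comm t (gen j)]

/-- **Every model matrix is unitary** (signed permutation matrices). -/
theorem modelMat_mem_unitaryGroup (ι : Fin k ⊕ Fin k) : modelMat ι ∈ Matrix.unitaryGroup (Blade k) ℂ := by
  cases ι with
  | inl j =>
      refine monomial_mem_unitaryGroup _ (gen j) (fun t => twist (ones k) (gen j) t) (modelMat_inl_apply j) ?_
      intro t; rw [twist_ones, star_exchSign_mul_self]
  | inr j =>
      refine monomial_mem_unitaryGroup _ (gen j) (fun t => psgn t * twist (ones k) t (gen j))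
        (modelMat_inr_apply j) ?_
      intro t
      rw [twist_ones, star_mul', star_psgn, star_exchSign]
      calc psgn t * exchSign ℂ t (gen j) * (psgn t * exchSign ℂ t (gen j))
          = (psgn t * psgn t) * (exchSign ℂ t (gen j) * exchSign ℂ t (gen j)) := by ring
        _ = 1 := by rw [psgn_mul_self, exchSign_mul_self, one_mul]


end Summit.QuantumAdvantage.Dequantization.CliffordDoubleModel
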